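import Mathlib

/-!
# Fourier–Mukai MODULAR law — MINT block B4 «alphabet FM», whole-group completion
# (hsemireg-alphabet-fm-1 g4, 2026-08-29)

Crux of record: `Summit.HodgeConjecture.HodgeConjecture.Theses.EightfoldBlochSeeds.BlochSeedDiscOne`
(`:= HasHyperbolicBlochSeed 4 1`; item stmt-HodgeConjecture-18881; skeleton `Cruxes/BlochSeedDiscOne/Lines/birth.lean`,
STUB R `stub_rung_pad4_seedAt` — UNTOUCHED here).  **Nothing in this file proves or approaches HC, HC_AV, HC_CM, H2,
№4/26512 or item 18881**: it is Mathlib-only arithmetic of binary forms (no `sorry`, no `instance`, no `notation`,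
no `axiom`), the CLASS-LEVEL shadow of the *whole* Fourier–Mukai group `⟨S = Φ_𝒫, T = ⊗𝒪(I)⟩ ↠ SL₂(ℤ)` acting on
the LINE letter alphabets and on the clean LINE classes of the cell.  Generations g0–g3 of this unit treated the
single involution `S = Φ_𝒫` (+ one normalising twist): `FourierMukaiLetterLaw.lean` (g1), `FourierMukaiTransportLaw.lean`
(g2), closing ledger g3.  This file answers «FM partners of the letters and of whole presentations» for EVERY word
in `S, T` at once.  Seats produce evidence and typed files, not rungs.

## Dictionary (per factor `S_f = E × E`, frame `⟨1, I, e, ē, pt⟩`, `I² = 2·pt`, `e·ē = −pt`; g1 `Frame`)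

* The `I`-line part `(s, l, p)` = (rank, `I`-coefficient, `χ`) of a Mukai vector `v = s + l·I + β·e + β̄·ē + p·pt`
  is read as Gauss's EVEN binary quadratic form **`Q_v(X, Y) = s·X² + 2l·XY + p·Y²`** (`BQF`, fields `A B C`).
  HILBERT LAW: `χ(v ⊗ 𝒪(tI)) = Q_v(t, 1)` (`BQF.chi_twist`); rank `= Q_v(1, 0)`, `χ = Q_v(0, 1)`.
* `T = ⊗𝒪(I)` substitutes `(X, Y) ↦ (X + Y, Y)` (`BQF.eval_twist`, matrix `M_T = (1 1; 0 1)`), `S = Φ_𝒫`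
  (`1 ↦ pt ↦ 1`, `I ↦ −I`; g1 `Frame.fm`) substitutes `(X, Y) ↦ (Y, −X)` (`BQF.eval_fm`, `M_S = (0 1; −1 0)`):
  **the FM group acts on Hilbert forms by linear substitution** (`BQF.subst`, `subst_subst` = matrix product,
  `disc_subst`: `disc ↦ det² · disc`), `−1 = [−1]^*` acts trivially (`eval_neg_neg`): the action is `PSL₂(ℤ)`.
* RANK LAW: `rank Φ_g(v) = |Q_v(x, y)|` and `χ(Φ_g(v)) = Q_v(x', y')` where `(x, y)`, `(x', y')` are the columns of
  the substitution matrix of `g` (`BQF.rank_subst`, `BQF.chi_subst`); the columns of `SL₂(ℤ)` are exactly the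
  primitive vectors, so **the ranks of all FM partners of `v` are the values of `Q_v` at primitive vectors**.
* LETTERS: `L_x`, `x = a·I + β·e + β̄·ē`, `N = ββ̄`: `Q = X² + 2aXY + (a² − N)Y² = (X + aY)² − N·Y²`, `disc = 4N`
  (`BQF.letter`); a LINE letter (level `c`, `c² = N`) has the REDUCIBLE form `(X + (a − c)Y)(X + (a + c)Y)`,
  `disc = (2c)²` (`BQF.lineLetter`); CUSP LAW: it lies on LINE `n` iff `Q(−n, 1) = 0` (`lineLetter_root_iff`: the two
  LINES through a letter are the two rational roots `−(a ± c)`; a letter on no LINE has irreducible `Q`, `|β|²` not a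
  square, `isSquare_of_root`); the level `c = √disc / 2` is an invariant of the whole orbit (`disc_subst`).
  `T^t`: `a ↦ a + t` (`twist_letter`); `S`: `Q ↦ (a² − N, −a, 1) = χ · Q_{x̂}`, `x̂ = −x/χ` the dual fractional
  letter of g1 (`fm_letter_eq_smul`).  Roots move by the inverse matrix (`eval_subst`): LINE `n ↦ n + t` under `T^t`,
  `n ↦ −1/n` under `S` (`lineLetter_line_twist`, `lineLetter_line_fm`; g1 `dualSlope_signed`).
* **THEOREM A (twist rigidity, `lineLetter_unimodular_only_on_twists`)**: for a LINE letter of level `|c| ≥ 2`,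
  `Q(x, y) = ±1 ⟹ y = 0`: over the WHOLE modular group the only partners of `L_x` that are (shifted) LINE BUNDLES are
  its twists `L_x(tI)`.  Level `1`: one extra family, the column `(−a, 1)` = «go to LINE 1 and dualise»
  (`lineLetter_level_one`: `Φ_𝒫(L_{βe+β̄ē}) = L_{∓(βe+β̄ē)}[−1]`); level `0` (`𝒪(aI)`): the affine line `x + ay = ±1`
  (`lineLetter_level_zero`); NON-LINE letters: Pell columns, infinitely many line-bundle partners (examples).
* CLEAN LINE CLASS `𝓖` (LINE `n`, `ch 𝓖(−nH) = γ − κH + μe⁴ + μ̄ē⁴` on `X = S⁴`, `H` principal, `H⁸ = 8!`): its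
  Hilbert form is the binary OCTIC **`F(x, y) = x⁷(γx − 8κy)`** (`cleanOctic`; `= chiLine` of g1 at `y = 1`; on `X`
  the group substitutes octics, `S : (X, Y) ↦ (−Y, X)`, `T` as before, Künneth).  Partner ranks `|F(x, y)|`:
  twists `γ` (`cleanOctic_twistColumn`); the `Φ_𝒫`-column and the second cusp `γx = 8κy` give rank `0`
  (`cleanOctic_fmColumn`, `cleanOctic_rootColumn`: torsion / genuine complexes, never bundles); unit columns
  `(±1, y)`, `y ≠ 0`: rank `≥ 8|κ| − γ` (`cleanOctic_unitColumn_ge`); all other columns: rank `≥ 128`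
  (`cleanOctic_large`) — `partner_rank_spectrum`.  **THEOREM B (`door_shut`, `rank_four_partner_is_twist`)**: for
  `γ = 4`, a rank-4 partner off the twist line forces `|κ| ≤ 1`; for the cell's designs (`κ̄ = 1704`, `410016`) the
  IT/locally-free DOOR of g0 is shut over the ENTIRE modular group, the nearest off-twist partner having rank
  `8κ̄ − 4 = 13628` (ac808a66, = g1/g3's LINE `1` value) resp. `3280124` (S131).
* INDEX (`letterIndex`, Part D): Mumford's index of `L_x(tI)` = number of negative linear factors of `Q` at `(t, 1)`
  = `[t < c − a] + [t < −(a + c)]`; `IT₀ ⟺ t ≥ c − a`, `IT₁ ⟺ −(a+c) ≤ t < c − a`, `IT₂ ⟺ t < −(a + c)` (off the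
  roots), and `sign χ = (−1)^index` (`letterIndex_eq_one_iff_chi_neg`): `Φ_𝒫(L_x(tI)) = E[−index]`, `E` simple
  semi-homogeneous of rank `|Q(t,1)|… = |χ|` [Mukai 1981 §3; arXiv:0906.4603 Fact 2.10, Prop 2.14].
* **ORLOV (Part E)**: autoequivalences modulo shifts, translations and `Pic⁰` = the isometric group `U(A × Â)`
  [Orlov 2002 = alg-geom/9712017, Def. before Prop 2.21, Thm 4.14].  `isometric_entry_law`: for a `2 × 2` matrix over
  a commutative ring with involution, `f·f̃ = 1` forces `f* = (det f)*·f` entrywise and `det f·(det f)* = 1`;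
  `gaussian_isometric`: over `ℤ[i]` (= `End` of the very general principally polarised Weil fibre, `*` = Rosati =
  complex conjugation) this leaves exactly `SL₂(ℤ) ⊔ i·SL₂(ℤ)` — the modular group and the CM unit `[i]_*`: the
  list of FM symmetries that travel sideways with a seed is COMPLETE, and Theorems A/B quantify all of it.

Worked example ac808a66 (LINE 14, `γ = 4`, `κ̄ = 1704`): the single modular move `g = Φ_𝒫 ∘ ⊗𝒪(−13I)` has matrix
`M_T^{−13} M_S = (13 1; −1 0)` (`ac808a66_move`), sends the level-`c` LINE-14 letter to a simple semi-homogeneous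
bundle of signed rank `1 − 2c` (`ac808a66_letters`: line bundles for `c ≤ 1`, ranks `3,5,7,9,11` for `c = 2…6`,
all in degree `1`, `ac808a66_letters_index`) and the class to rank `13628` (`ac808a66_column_1_1`); two-term stays
two-term, monad stays monad (the group acts on class AND alphabet: a symmetry, not a door — g0's verdict, now for
every `g`).  Labels: [std] arithmetic; the geometric readings in the docstrings are [std: Mukai 1981, Orlov 2002,
Birkenhake–Lange CAV §14, Yoshioka–Yanagida 0906.4603] and are NOT formalised here.
-/

namespace Summit.HodgeConjecture.HodgeConjecture.Cruxes.BlochSeedDiscOne.FourierMukaiModularLaw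

/-! ## Part A — even binary quadratic forms: the hyperbolic triple `(rank, c₁·I, χ)` of a Mukai vector -/

/-- The `I`-line part `s·1 + l·I + p·pt` of a per-factor Mukai vector, read as Gauss's even form
`Q = A·X² + 2B·XY + C·Y²` with `A = s` (rank), `B = l` (`I`-coefficient), `C = p = χ`. -/
@[ext]
structure BQF (R : Type*) where
  /-- rank `s` = coefficient of `X²` -/
  A : R
  /-- `I`-coefficient `l` = half the coefficient of `XY` -/
  B : R
  /-- Euler characteristic `p = χ` = coefficient of `Y²` -/
  C : R

namespace BQF

variable {R : Type*} [CommRing R]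

/-- the value `Q(x, y)`. -/
def eval (Q : BQF R) (x y : R) : R := Q.A * x ^ 2 + 2 * Q.B * x * y + Q.C * y ^ 2

/-- discriminant `(2B)² − 4AC`. -/
def disc (Q : BQF R) : R := 4 * (Q.B ^ 2 - Q.A * Q.C)

/-- the even-cohomology product restricted to the `I`-line (`I² = 2·pt`, `I·pt = pt² = 0`). -/
def mul (v w : BQF R) : BQF R :=
  ⟨v.A * w.A, v.A * w.B + v.B * w.A, v.A * w.C + 2 * v.B * w.B + v.C * w.A⟩

/-- `ch 𝒪(t·I) = 1 + t·I + t²·pt`. -/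
def expI (t : R) : BQF R := ⟨1, t, t ^ 2⟩

/-- `T^t = ⊗ 𝒪(t·I)` on vectors. -/
def twist (t : R) (Q : BQF R) : BQF R := ⟨Q.A, Q.B + t * Q.A, Q.C + 2 * t * Q.B + t ^ 2 * Q.A⟩

/-- `S = Φ_𝒫` on vectors: `1 ↦ pt`, `I ↦ −I`, `pt ↦ 1` (g1 `Frame.fm` restricted to the `I`-line). -/
def fm (Q : BQF R) : BQF R := ⟨Q.C, -Q.B, Q.A⟩

/-- rank-`r` multiple (the vector `r · exp x̂` of a semi-homogeneous bundle of slope form `Q_{x̂}`). -/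
def smul (r : R) (Q : BQF R) : BQF R := ⟨r * Q.A, r * Q.B, r * Q.C⟩

/-- linear substitution `X ↦ x·X + x'·Y`, `Y ↦ y·X + y'·Y`, i.e. `Q ↦ Q ∘ M` for the matrix `M` with columns
`(x, y)` and `(x', y')`. -/
def subst (Q : BQF R) (x x' y y' : R) : BQF R :=
  ⟨Q.eval x y, Q.A * x * x' + Q.B * (x * y' + x' * y) + Q.C * y * y', Q.eval x' y'⟩

theorem eval_subst (Q : BQF R) (x x' y y' X Y : R) :
    (Q.subst x x' y y').eval X Y = Q.eval (x * X + x' * Y) (y * X + y' * Y) := by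
  simp only [subst, eval]; ring

/-- RANK LAW: the rank of the transformed vector is the value of the form at the FIRST column. -/
theorem rank_subst (Q : BQF R) (x x' y y' : R) : (Q.subst x x' y y').A = Q.eval x y := rfl

/-- … and its Euler characteristic is the value at the SECOND column. -/
theorem chi_subst (Q : BQF R) (x x' y y' : R) : (Q.subst x x' y y').C = Q.eval x' y' := rfl

theorem rank_eq_eval (Q : BQF R) : Q.A = Q.eval 1 0 := by
  simp only [eval]; ring

theorem chi_eq_eval (Q : BQF R) : Q.C = Q.eval 0 1 := by
  simp only [eval]; ring

theorem twist_eq_mul_expI (t : R) (Q : BQF R) : twist t Q = mul Q (expI t) := by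
  ext <;> simp only [twist, mul, expI] <;> ring

/-- HILBERT LAW: `χ(v ⊗ 𝒪(tI)) = Q_v(t, 1)`. -/
theorem chi_twist (t : R) (Q : BQF R) : (twist t Q).C = Q.eval t 1 := by
  simp only [twist, eval]; ring

theorem rank_twist (t : R) (Q : BQF R) : (twist t Q).A = Q.A := rfl

theorem twist_eq_subst (t : R) (Q : BQF R) : twist t Q = Q.subst 1 t 0 1 := by
  ext <;> simp only [twist, subst, eval] <;> ring

theorem fm_eq_subst (Q : BQF R) : fm Q = Q.subst 0 1 (-1) 0 := by
  ext <;> simp only [fm, subst, eval] <;> ring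

/-- `T = ⊗𝒪(tI)` substitutes `(X, Y) ↦ (X + tY, Y)`. -/
theorem eval_twist (t : R) (Q : BQF R) (X Y : R) : (twist t Q).eval X Y = Q.eval (X + t * Y) Y := by
  simp only [twist, eval]; ring

/-- `S = Φ_𝒫` substitutes `(X, Y) ↦ (Y, −X)`. -/
theorem eval_fm (Q : BQF R) (X Y : R) : (fm Q).eval X Y = Q.eval Y (-X) := by
  simp only [fm, eval]; ring

/-- rank and `χ` are swapped by `Φ_𝒫` (g1 `Design.rank_fm` / `Design.chi_fm` on the `I`-line). -/
theorem rank_fm (Q : BQF R) : (fm Q).A = Q.C := rfl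

theorem chi_fm (Q : BQF R) : (fm Q).C = Q.A := rfl

theorem fm_fm (Q : BQF R) : fm (fm Q) = Q := by
  ext <;> simp [fm]

theorem twist_twist (s t : R) (Q : BQF R) : twist s (twist t Q) = twist (t + s) Q := by
  ext <;> simp only [twist] <;> ring

theorem twist_zero (Q : BQF R) : twist 0 Q = Q := by
  ext <;> simp [twist]

/-- composition = matrix product `(Q ∘ M) ∘ N = Q ∘ (M·N)`: the FM group acts on Hilbert forms on the right
through its substitution matrices (`M_T = (1 1; 0 1)`, `M_S = (0 1; −1 0)`, both of determinant `1`). -/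
theorem subst_subst (Q : BQF R) (x x' y y' u u' w w' : R) :
    (Q.subst x x' y y').subst u u' w w' =
      Q.subst (x * u + x' * w) (x * u' + x' * w') (y * u + y' * w) (y * u' + y' * w') := by
  ext <;> simp only [subst, eval] <;> ring

theorem subst_one (Q : BQF R) : Q.subst 1 0 0 1 = Q := by
  ext <;> simp only [subst, eval] <;> ring

/-- the discriminant transforms by `det²`: it is an invariant of the whole `SL₂(ℤ)`-orbit. -/
theorem disc_subst (Q : BQF R) (x x' y y' : R) :
    (Q.subst x x' y y').disc = (x * y' - x' * y) ^ 2 * Q.disc := by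
  simp only [subst, disc, eval]; ring

theorem disc_twist (t : R) (Q : BQF R) : (twist t Q).disc = Q.disc := by
  simp only [twist, disc]; ring

theorem disc_fm (Q : BQF R) : (fm Q).disc = Q.disc := by
  simp only [fm, disc]; ring

/-- `−1 ∈ SL₂(ℤ)` (`= [−1]^*`, trivial on even cohomology) acts trivially: the action factors through `PSL₂(ℤ)`. -/
theorem eval_neg_neg (Q : BQF R) (x y : R) : Q.eval (-x) (-y) = Q.eval x y := by
  simp only [eval]; ring

theorem subst_neg (Q : BQF R) (x x' y y' : R) :
    Q.subst (-x) (-x') (-y) (-y') = Q.subst x x' y y' := by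
  ext <;> simp only [subst, eval] <;> ring

/-- forms are homogeneous of degree `2`. -/
theorem eval_smul_args (Q : BQF R) (r x y : R) : Q.eval (r * x) (r * y) = r ^ 2 * Q.eval x y := by
  simp only [eval]; ring

/-! ## Part B — letters, LINE letters, the cusp law, and THEOREM A (twist rigidity) -/

/-- the Hilbert form of the line bundle `L_x`, `x = a·I + β·e + β̄·ē`, `N = ββ̄ = |β|²`:
`v = exp x = (1, a, β, β̄, a² − N)` (g1 `Frame.exp`) ↦ `X² + 2aXY + (a² − N)Y²`. -/
def letter (a N : R) : BQF R := ⟨1, a, a ^ 2 - N⟩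

theorem eval_letter (a N x y : R) : (letter a N).eval x y = (x + a * y) ^ 2 - N * y ^ 2 := by
  simp only [letter, eval]; ring

theorem disc_letter (a N : R) : (letter a N).disc = 4 * N := by
  simp only [letter, disc]; ring

/-- `L_x ⊗ 𝒪(tI) = L_{x + tI}`: `a ↦ a + t`, `β` fixed. -/
theorem twist_letter (t a N : R) : twist t (letter a N) = letter (a + t) N := by
  ext <;> simp only [twist, letter] <;> ring

/-- `Φ_𝒫(exp x) = (χ, −a, 1)` on the `I`-line, `χ = a² − N` (g1 `Frame.fm_exp`). -/
theorem fm_letter (a N : R) : fm (letter a N) = ⟨a ^ 2 - N, -a, 1⟩ := by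
  ext <;> simp [fm, letter]

/-- … `= χ · exp x̂` with the dual FRACTIONAL letter `x̂ = −x/χ`: slope `−a/χ`, `|β̂|² = N/χ²`
(g1 `Frame.fm_exp_eq_smul`; a simple semi-homogeneous bundle of rank `|χ|`, Mukai 1981 §3). -/
theorem fm_letter_eq_smul {K : Type*} [Field K] {a N : K} (hχ : a ^ 2 - N ≠ 0) :
    fm (letter a N) = smul (a ^ 2 - N) (letter (-a / (a ^ 2 - N)) (N / (a ^ 2 - N) ^ 2)) := by
  ext <;> simp only [fm, letter, smul] <;> field_simp

/-- a LINE letter: level `c` with `c² = N` (`c = |β| ∈ ℕ`); it lies on LINE `a + c` (cell convention `a = n − c`)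
and also on LINE `a − c`. -/
def lineLetter (a c : R) : BQF R := letter a (c ^ 2)

/-- the Hilbert form of a LINE letter is REDUCIBLE: two linear factors, roots `X/Y = −(a − c)` and `−(a + c)`. -/
theorem eval_lineLetter (a c x y : R) :
    (lineLetter a c).eval x y = (x + (a - c) * y) * (x + (a + c) * y) := by
  simp only [lineLetter, letter, eval]; ring

/-- `disc = (2c)²`: the level is `√disc / 2`, an invariant of the whole orbit (`disc_subst`). -/
theorem disc_lineLetter (a c : R) : (lineLetter a c).disc = (2 * c) ^ 2 := by
  simp only [lineLetter, letter, disc]; ring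

theorem twist_lineLetter (t a c : R) : twist t (lineLetter a c) = lineLetter (a + t) c := by
  simp only [lineLetter, twist_letter]

/-- CUSP LAW: a LINE-`n` letter (`n = a + c`) has `Q(−n, 1) = 0` — its Hilbert form vanishes at the cusp `−n`,
i.e. `χ(L_x(−nI)) = 0` (the normal form `exp(x − nI) = 1 + y`, `y` null, of g1 `Frame.twist_normalForm`). -/
theorem lineLetter_root (a c : R) : (lineLetter a c).eval (-(a + c)) 1 = 0 := by
  rw [eval_lineLetter]; ring

theorem lineLetter_root' (a c : R) : (lineLetter a c).eval (-(a - c)) 1 = 0 := by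
  rw [eval_lineLetter]; ring

/-- … and conversely: the LINES through a letter are exactly the roots of its Hilbert form. -/
theorem lineLetter_root_iff (a c n : ℤ) :
    (lineLetter a c).eval (-n) 1 = 0 ↔ n = a + c ∨ n = a - c := by
  rw [eval_lineLetter, mul_eq_zero]
  omega

/-- a letter whose Hilbert form has an integral root is a LINE letter: `|β|²` is a perfect square
(letters on no LINE have irreducible forms). -/
theorem isSquare_of_root {a N x : ℤ} (h : (letter a N).eval x 1 = 0) : IsSquare N := by
  refine ⟨x + a, ?_⟩
  rw [eval_letter] at h
  linear_combination (-1 : ℤ) * h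

/-- roots move by the inverse substitution: LINE `n ↦ n + t` under `T^t` … -/
theorem lineLetter_line_twist (a c t : R) :
    (twist t (lineLetter a c)).eval (-(a + c + t)) 1 = 0 := by
  rw [eval_twist, eval_lineLetter]; ring

/-- … and LINE `n ↦ −1/n` under `S = Φ_𝒫` (root at `X/Y = 1/n`; g1 `dualSlope_signed`). -/
theorem lineLetter_line_fm (a c : R) : (fm (lineLetter a c)).eval 1 (a + c) = 0 := by
  rw [eval_fm, eval_lineLetter]; ring

theorem line_fm_of_line (Q : BQF R) {n : R} (h : Q.eval (-n) 1 = 0) : (fm Q).eval 1 n = 0 := by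
  rw [eval_fm, ← eval_neg_neg]
  simpa using h

/-- the twist columns `(x, 0)`: value `A·x²`; for a letter `x²`, unimodular iff `x = ±1` (`±T^t`, the Borel part). -/
theorem eval_twistColumn (Q : BQF R) (x : R) : Q.eval x 0 = Q.A * x ^ 2 := by
  simp only [eval]; ring

theorem lineLetter_twistColumn (a c x : R) : (lineLetter a c).eval x 0 = x ^ 2 := by
  simp only [lineLetter, letter, eval]; ring

/-- if `2 ≤ |c|` and `|c·y| ≤ 1` then `y = 0`. -/
theorem eq_zero_of_abs_mul_le_one {c y : ℤ} (hc : 2 ≤ |c|) (h : |c * y| ≤ 1) : y = 0 := by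
  by_contra hy
  have hy1 : 1 ≤ |y| := Int.one_le_abs hy
  rw [abs_mul] at h
  have : (2 : ℤ) * 1 ≤ |c| * |y| := mul_le_mul hc hy1 (by norm_num) (abs_nonneg c)
  linarith

/-- **THEOREM A (twist rigidity of LINE letters).**  For a LINE letter of level `|c| ≥ 2` the Hilbert form takes a
unit value `±1` only on the twist line `y = 0`: over the WHOLE modular group `⟨Φ_𝒫, ⊗𝒪(I)⟩` the only Fourier–Mukai
partners of `L_x` that are (shifted) line bundles are the twists `L_x(tI)` (g3 §4.1 did `Φ_𝒫 ∘ T^t` only).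
Proof: `Q(x,y) = (x + (a−c)y)(x + (a+c)y) = ±1` forces both factors `= ±1`, whose difference is `2cy`. -/
theorem lineLetter_unimodular_only_on_twists {a c x y : ℤ} (hc : 2 ≤ |c|)
    (h : (lineLetter a c).eval x y = 1 ∨ (lineLetter a c).eval x y = -1) : y = 0 := by
  apply eq_zero_of_abs_mul_le_one hc
  rw [eval_lineLetter] at h
  have e : 2 * (c * y) = (x + (a + c) * y) - (x + (a - c) * y) := by ring
  have hcy : c * y = 0 ∨ c * y = 1 ∨ c * y = -1 := by
    rcases h with h | h
    · rcases Int.eq_one_or_neg_one_of_mul_eq_one' h with ⟨h1, h2⟩ | ⟨h1, h2⟩ <;>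
        rw [h1, h2] at e <;> omega
    · rcases Int.eq_one_or_neg_one_of_mul_eq_neg_one' h with ⟨h1, h2⟩ | ⟨h1, h2⟩ <;>
        rw [h1, h2] at e <;> omega
  rcases hcy with h0 | h0 | h0 <;> simp [h0]

/-- contrapositive packaging: off the twist line a level-`≥ 2` LINE letter has NO line-bundle partner. -/
theorem lineLetter_no_unit_off_twist {a c x y : ℤ} (hc : 2 ≤ |c|) (hy : y ≠ 0) :
    (lineLetter a c).eval x y ≠ 1 ∧ (lineLetter a c).eval x y ≠ -1 :=
  ⟨fun h => hy (lineLetter_unimodular_only_on_twists hc (Or.inl h)),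
    fun h => hy (lineLetter_unimodular_only_on_twists hc (Or.inr h))⟩

/-- level `1`: the extra unimodular column `(−a, 1)` = «twist to LINE 1, then dualise»:
`Φ_𝒫(L_{βe+β̄ē}) = L_{∓(βe+β̄ē)}[−1]`, the LINE-1 self-duality (`χ = −1`, index `1`). -/
theorem lineLetter_level_one (a : ℤ) : (lineLetter a 1).eval (-a) 1 = -1 := by
  rw [eval_lineLetter]; ring

/-- level `0` (`L = 𝒪(aI)`): `Q = (x + ay)²`, unimodular on the whole affine line `x + ay = ±1`
(the powers of the principal polarisation have line-bundle partners in every direction). -/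
theorem lineLetter_level_zero (a x y : ℤ) : (lineLetter a 0).eval x y = (x + a * y) ^ 2 := by
  rw [eval_lineLetter]; ring

/-- a NON-LINE letter, `|β|² = 2` (e.g. `β = 1 + i`), `a = 0`: `Q = X² − 2Y²` is a Pell form — the columns
`(3, 2)`, `(17, 12)`, … are unimodular: infinitely many line-bundle partners off the twist line.  Theorem A is a
statement about LINE letters (square discriminant) only. -/
theorem pell_letter_partner : (letter (0 : ℤ) 2).eval 3 2 = 1 := by
  norm_num [eval, letter]

theorem pell_letter_partner' : (letter (0 : ℤ) 2).eval 17 12 = 1 := by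
  norm_num [eval, letter]

end BQF

open BQF

/-! ## Part C — the clean LINE class: a binary octic, and THEOREM B (the IT-door over the whole group) -/

/-- Hilbert form of the LINE-normalised clean class `𝓖₀ = 𝓖(−nH)`, `ch 𝓖₀ = γ − κH + μe⁴ + μ̄ē⁴` on `X = S⁴`
(`H = Σ I_f` principal, `H⁸ = 8!`, `e⁴·H⁴ = 0`): `F(x, y) = y⁸ χ(𝓖₀((x/y)H)) = x⁷(γx − 8κy)`
(g1 `chiLine x γ κ` at `y = 1`).  The modular group substitutes octics exactly as it substitutes the per-factor
quadratic forms (Künneth: `∫_X ⊗v_f · e^{tH} = Π_f Q_{v_f}(t, 1)`, `Φ_𝒫 = ⊠_f Φ_{𝒫_f}`), so the ranks of the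
FM partners `Φ_g(𝓖)` are the values `|F(x, y)|` at primitive columns `(x, y)`. -/
def cleanOctic (γ κ x y : ℤ) : ℤ := x ^ 7 * (γ * x - 8 * κ * y)

theorem cleanOctic_one (γ κ x : ℤ) : cleanOctic γ κ x 1 = x ^ 7 * (γ * x - 8 * κ) := by
  simp [cleanOctic]

/-- degree `8` is even: `−1` acts trivially here too. -/
theorem cleanOctic_neg_neg (γ κ x y : ℤ) : cleanOctic γ κ (-x) (-y) = cleanOctic γ κ x y := by
  unfold cleanOctic; ring

/-- the twist columns `(x, 0)` (`x = ±1` primitive): rank `γ` — the class itself, `𝓖(tH)`. -/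
theorem cleanOctic_twistColumn (γ κ x : ℤ) : cleanOctic γ κ x 0 = γ * x ^ 8 := by
  unfold cleanOctic; ring

/-- the `Φ_𝒫`-column `(0, ±1)`: rank `0` (`χ(𝓖₀) = 0`: a sevenfold root at the class's own LINE) —
`Φ_𝒫(𝓖(−nH))` is torsion or a genuine complex, never a bundle. -/
theorem cleanOctic_fmColumn (γ κ y : ℤ) : cleanOctic γ κ 0 y = 0 := by
  simp [cleanOctic]

/-- the second cusp `γx = 8κy` (LINE `n + 8κ/γ`, `= n + 3408` for ac808a66): rank `0` again. -/
theorem cleanOctic_rootColumn {γ κ x y : ℤ} (h : γ * x = 8 * κ * y) : cleanOctic γ κ x y = 0 := by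
  simp [cleanOctic, h]

/-- `|x⁷ k| < 128 = 2⁷` with `k ≠ 0` forces `|x| ≤ 1` (g1 `abs_le_one_of_chiLine_lt`, restated). -/
theorem abs_le_one_of_octic_lt {x k : ℤ} (hk : k ≠ 0) (h : |x ^ 7 * k| < 128) : |x| ≤ 1 := by
  rcases le_or_gt |x| 1 with hle | hx
  · exact hle
  exfalso
  have h2 : (2 : ℤ) ≤ |x| := by
    have := Int.add_one_le_iff.mpr hx
    linarith
  have hk1 : 1 ≤ |k| := Int.one_le_abs hk
  have h7 : (2 : ℤ) ^ 7 ≤ |x| ^ 7 := pow_le_pow_left₀ (by norm_num) h2 7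
  rw [abs_mul, abs_pow] at h
  nlinarith

/-- columns with `|x| ≥ 2` off the second cusp: rank `≥ 128`. -/
theorem cleanOctic_large {γ κ x y : ℤ} (hx : 2 ≤ |x|) (hk : γ * x - 8 * κ * y ≠ 0) :
    128 ≤ |cleanOctic γ κ x y| := by
  by_contra h
  push Not at h
  unfold cleanOctic at h
  have := abs_le_one_of_octic_lt hk h
  linarith

/-- the unit columns `(±1, y)`, `y ≠ 0`: rank `|γ ∓ 8κy| ≥ 8|κ| − γ`. -/
theorem cleanOctic_unitColumn_ge {γ κ x y : ℤ} (hγ : 0 ≤ γ) (hy : y ≠ 0) (hx : |x| = 1) :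
    8 * |κ| - γ ≤ |cleanOctic γ κ x y| := by
  have hy1 : 1 ≤ |y| := Int.one_le_abs hy
  have h8 : 8 * |κ| ≤ |8 * κ * y| := by
    rw [abs_mul, abs_mul, abs_of_pos (by norm_num : (0 : ℤ) < 8)]
    nlinarith [abs_nonneg κ]
  rcases (abs_eq (by norm_num : (0 : ℤ) ≤ 1)).1 hx with rfl | rfl
  · have e : cleanOctic γ κ 1 y = -(8 * κ * y - γ) := by unfold cleanOctic; ring
    rw [e, abs_neg]
    have := abs_sub_abs_le_abs_sub (8 * κ * y) γ
    rw [abs_of_nonneg hγ] at this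
    linarith
  · have e : cleanOctic γ κ (-1) y = 8 * κ * y - (-γ) := by unfold cleanOctic; ring
    rw [e]
    have := abs_sub_abs_le_abs_sub (8 * κ * y) (-γ)
    rw [abs_neg, abs_of_nonneg hγ] at this
    linarith

/-- `κ·y ∈ {0, ±1}` with `y ≠ 0` forces `|κ| ≤ 1`. -/
theorem abs_le_one_of_mul_trichotomy {κ y : ℤ} (hy : y ≠ 0) (h : κ * y = 0 ∨ κ * y = 1 ∨ κ * y = -1) :
    |κ| ≤ 1 := by
  rcases h with h | h | h
  · rcases mul_eq_zero.1 h with rfl | rfl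
    · simp
    · exact absurd rfl hy
  · rcases Int.eq_one_or_neg_one_of_mul_eq_one' h with ⟨rfl, -⟩ | ⟨rfl, -⟩ <;> simp
  · rcases Int.eq_one_or_neg_one_of_mul_eq_neg_one' h with ⟨rfl, -⟩ | ⟨rfl, -⟩ <;> simp

/-- **THEOREM B (the IT-door is shut over the whole modular group).**  For `γ = 4`: a rank-`4` partner OFF the
twist line (`y ≠ 0`) forces `|κ| ≤ 1`.  (g0 closed the door for `Φ_𝒫` by `c₈ = (κ⁸ + 36|μ|²)pt ≠ 0`; here every
word in `Φ_𝒫, ⊗𝒪(I)` is covered by one inequality.) -/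
theorem door_shut {κ x y : ℤ} (hy : y ≠ 0) (h : |cleanOctic 4 κ x y| = 4) : |κ| ≤ 1 := by
  have hk : 4 * x - 8 * κ * y ≠ 0 := by
    intro h0
    have : cleanOctic 4 κ x y = 0 := by unfold cleanOctic; rw [h0, mul_zero]
    rw [this] at h
    norm_num at h
  have hlt : |x ^ 7 * (4 * x - 8 * κ * y)| < 128 := by
    have h' := h
    unfold cleanOctic at h'
    rw [h']
    norm_num
  have hx : |x| ≤ 1 := abs_le_one_of_octic_lt hk hlt
  have hx3 : x = 0 ∨ x = 1 ∨ x = -1 := by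
    rcases abs_le.1 hx with ⟨h1, h2⟩
    omega
  apply abs_le_one_of_mul_trichotomy hy
  rcases hx3 with rfl | rfl | rfl
  · rw [cleanOctic_fmColumn] at h
    norm_num at h
  · have e : cleanOctic 4 κ 1 y = 4 - 8 * (κ * y) := by unfold cleanOctic; ring
    rw [e] at h
    rcases (abs_eq (by norm_num : (0 : ℤ) ≤ 4)).1 h with h' | h' <;> omega
  · have e : cleanOctic 4 κ (-1) y = 4 + 8 * (κ * y) := by unfold cleanOctic; ring
    rw [e] at h
    rcases (abs_eq (by norm_num : (0 : ℤ) ≤ 4)).1 h with h' | h' <;> omega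

/-- Corollary: for `|κ| ≥ 2` (the cell: `κ̄ = 1704`, `410016`) the rank-`4` partners of the clean class are
exactly its twists `𝓖(tH)` (and their shifts / `[i]_*` / `[−1]^*` images). -/
theorem rank_four_partner_is_twist {κ x y : ℤ} (hκ : 2 ≤ |κ|) (h : |cleanOctic 4 κ x y| = 4) : y = 0 := by
  by_contra hy
  have := door_shut hy h
  linarith

/-- THE PARTNER-RANK SPECTRUM of a clean LINE class (`γ ≥ 0`): every column gives rank `0` (the two cusps),
or lies on the twist line, or has rank `≥ 8|κ| − γ` (unit columns), or rank `≥ 128`. -/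
theorem partner_rank_spectrum {γ κ x y : ℤ} (hγ : 0 ≤ γ) :
    cleanOctic γ κ x y = 0 ∨ y = 0 ∨ 8 * |κ| - γ ≤ |cleanOctic γ κ x y| ∨ 128 ≤ |cleanOctic γ κ x y| := by
  rcases le_or_gt 2 |x| with hx | hx
  · by_cases hk : γ * x - 8 * κ * y = 0
    · left
      unfold cleanOctic; rw [hk, mul_zero]
    · right; right; right
      exact cleanOctic_large hx hk
  · have hx1 : |x| ≤ 1 := by omega
    have hx3 : x = 0 ∨ x = 1 ∨ x = -1 := by
      rcases abs_le.1 hx1 with ⟨h1, h2⟩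
      omega
    rcases hx3 with rfl | rfl | rfl
    · left; exact cleanOctic_fmColumn γ κ y
    · by_cases hy : y = 0
      · right; left; exact hy
      · right; right; left; exact cleanOctic_unitColumn_ge hγ hy (by simp)
    · by_cases hy : y = 0
      · right; left; exact hy
      · right; right; left; exact cleanOctic_unitColumn_ge hγ hy (by simp)

/-! ### Worked examples: ac808a66 (`γ = 4`, `κ̄ = 1704`, LINE 14) and S131 (`κ̄ = 410016`, LINE 16) -/

/-- the nearest partner off the twist line: `8κ̄ − γ = 13628`. -/
theorem ac808a66_min_offTwist : 8 * |(1704 : ℤ)| - 4 = 13628 := by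
  rw [abs_of_nonneg (by norm_num : (0 : ℤ) ≤ 1704)]; norm_num

/-- column `(1, 1)` of `𝓖₀` (= LINE `1` = column `(−13, 1)` of `𝓖` on LINE 14): signed rank `−13628`
(g1 `chiLine_ac808a66_lineOne`). -/
theorem ac808a66_column_1_1 : cleanOctic 4 1704 1 1 = -13628 := by norm_num [cleanOctic]

/-- columns `(−1, 1)` and `(1, −1)` (LINE `−1`): `13636 = 8κ̄ + γ` (g1 `chiLine_ac808a66_lineNegOne`). -/
theorem ac808a66_column_neg1_1 : cleanOctic 4 1704 (-1) 1 = 13636 := by norm_num [cleanOctic]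

theorem ac808a66_column_1_neg1 : cleanOctic 4 1704 1 (-1) = 13636 := by norm_num [cleanOctic]

/-- the first column with `|x| = 2`: rank `2⁷ · 13624 = 1743872`. -/
theorem ac808a66_column_2_1 : cleanOctic 4 1704 2 1 = -1743872 := by norm_num [cleanOctic]

/-- the second cusp, column `(3408, 1)`: rank `0` (`4 · 3408 = 8 · 1704`). -/
theorem ac808a66_secondCusp : cleanOctic 4 1704 3408 1 = 0 := by norm_num [cleanOctic]

theorem S131_min_offTwist : 8 * |(410016 : ℤ)| - 4 = 3280124 := by
  rw [abs_of_nonneg (by norm_num : (0 : ℤ) ≤ 410016)]; norm_num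

theorem S131_column_1_1 : cleanOctic 4 410016 1 1 = -3280124 := by norm_num [cleanOctic]

/-- for the cell's designs no rank-4 partner exists off the twist line (instances of `rank_four_partner_is_twist`). -/
theorem ac808a66_rank_four {x y : ℤ} (h : |cleanOctic 4 1704 x y| = 4) : y = 0 :=
  rank_four_partner_is_twist (by rw [abs_of_nonneg (by norm_num : (0 : ℤ) ≤ 1704)]; norm_num) h

theorem S131_rank_four {x y : ℤ} (h : |cleanOctic 4 410016 x y| = 4) : y = 0 :=
  rank_four_partner_is_twist (by rw [abs_of_nonneg (by norm_num : (0 : ℤ) ≤ 410016)]; norm_num) h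

/-- ac808a66, the modular move `g = Φ_𝒫 ∘ ⊗𝒪(−13·I)` (LINE 14 → LINE 1 → dual): its substitution matrix is
`M_T^{−13} · M_S = (13 1; −1 0)`, first column `(13, −1) ≡ (−13, 1)`. -/
theorem ac808a66_move (Q : BQF ℤ) : fm (twist (-13) Q) = Q.subst 13 1 (-1) 0 := by
  rw [twist_eq_subst, fm_eq_subst, subst_subst]
  norm_num

/-- … under it the level-`c` LINE-14 letter (`a = 14 − c`) acquires signed rank `χ(L(−13I)) = 1 − 2c`:
line bundles for `c ∈ {0, 1}` (`𝒪(14I) ↦ 𝒪(−I)`, and the LINE-1 self-duality), simple semi-homogeneous bundles of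
ranks `3, 5, 7, 9, 11` for `c = 2, …, 6` — consistent with Theorem A. -/
theorem ac808a66_letters (c : ℤ) : (fm (twist (-13) (lineLetter (14 - c) c))).A = 1 - 2 * c := by
  simp only [fm, twist, lineLetter, letter]
  ring

/-! ## Part D — the index of a letter along its orbit (IT / WIT bookkeeping) -/

/-- number of negative entries among two integers. -/
def negCount (u v : ℤ) : ℕ := (if u < 0 then 1 else 0) + (if v < 0 then 1 else 0)

/-- Mumford index of the letter `(a, β)` (`|β| = c ≥ 0`) twisted by `𝒪(tI)`: the number of positive roots of
`s ↦ χ(L_x((t + s)I)) = (s + t + a − c)(s + t + a + c)`, i.e. of negative linear factors of `Q` at `(t, 1)`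
[Mumford, Abelian Varieties §16; Orlov alg-geom/9712017 p. 13].  Off the roots, `L_x(tI)` is `IT_index` and
`Φ_𝒫(L_x(tI)) = E[−index]`, `E` a simple semi-homogeneous bundle of rank `|χ|` [Mukai 1981 §3]. -/
def letterIndex (a c t : ℤ) : ℕ := negCount (t + a - c) (t + a + c)

theorem letterIndex_le_two (a c t : ℤ) : letterIndex a c t ≤ 2 := by
  unfold letterIndex negCount
  by_cases h1 : t + a - c < 0 <;> by_cases h2 : t + a + c < 0 <;> simp [h1, h2]

/-- `IT₀` (ample side): `t ≥ c − a`. -/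
theorem letterIndex_eq_zero_iff {a c t : ℤ} (hc : 0 ≤ c) : letterIndex a c t = 0 ↔ c - a ≤ t := by
  unfold letterIndex negCount
  by_cases h1 : t + a - c < 0 <;> by_cases h2 : t + a + c < 0 <;> simp [h1, h2] <;> omega

/-- `IT₂` (anti-ample side): `t < −(a + c)`. -/
theorem letterIndex_eq_two_iff {a c t : ℤ} (hc : 0 ≤ c) : letterIndex a c t = 2 ↔ t < -(a + c) := by
  unfold letterIndex negCount
  by_cases h1 : t + a - c < 0 <;> by_cases h2 : t + a + c < 0 <;> simp [h1, h2] <;> omega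

/-- `IT₁` / the mixed window: `−(a + c) ≤ t < c − a` (it contains the lower root `t = −(a+c)`, where `L` is
degenerate; off it the window is `IT₁`). -/
theorem letterIndex_eq_one_iff {a c t : ℤ} (hc : 0 ≤ c) :
    letterIndex a c t = 1 ↔ -(a + c) ≤ t ∧ t < c - a := by
  unfold letterIndex negCount
  by_cases h1 : t + a - c < 0 <;> by_cases h2 : t + a + c < 0 <;> simp [h1, h2] <;> omega

/-- `sign χ = (−1)^index` off the roots: index `1` iff `χ(L_x(tI)) = Q(t, 1) < 0`. -/
theorem letterIndex_eq_one_iff_chi_neg {a c t : ℤ} (hc : 0 ≤ c) (hχ : (lineLetter a c).eval t 1 ≠ 0) :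
    letterIndex a c t = 1 ↔ (lineLetter a c).eval t 1 < 0 := by
  rw [letterIndex_eq_one_iff hc]
  rw [eval_lineLetter] at hχ ⊢
  constructor
  · rintro ⟨h1, h2⟩
    have hne : t + (a + c) * 1 ≠ 0 := fun h0 => hχ (by rw [h0, mul_zero])
    apply mul_neg_of_neg_of_pos <;> omega
  · intro h
    rcases mul_neg_iff.1 h with ⟨h1, h2⟩ | ⟨h1, h2⟩ <;> constructor <;> omega

/-- … and index `∈ {0, 2}` iff `χ > 0`. -/
theorem letterIndex_ne_one_iff_chi_pos {a c t : ℤ} (hc : 0 ≤ c) (hχ : (lineLetter a c).eval t 1 ≠ 0) :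
    letterIndex a c t ≠ 1 ↔ 0 < (lineLetter a c).eval t 1 := by
  have key := letterIndex_eq_one_iff_chi_neg hc hχ
  constructor
  · intro h
    rcases lt_trichotomy ((lineLetter a c).eval t 1) 0 with hlt | heq | hgt
    · exact absurd (key.2 hlt) h
    · exact absurd heq hχ
    · exact hgt
  · intro h h1
    have := key.1 h1
    linarith

/-- ac808a66: under `Φ_𝒫 ∘ ⊗𝒪(−13I)` every LINE-14 letter of level `c ≥ 1` sits in degree `1`
(`Φ_𝒫(L(−13I)) = E[−1]`), the level-`0` letter `𝒪(14I)` in degree `0`. -/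
theorem ac808a66_letters_index (c : ℤ) (hc : 1 ≤ c) : letterIndex (14 - c) c (-13) = 1 := by
  rw [letterIndex_eq_one_iff (by omega)]
  constructor <;> omega

theorem ac808a66_letters_index_zero : letterIndex 14 0 (-13) = 0 := by
  rw [letterIndex_eq_zero_iff le_rfl]
  norm_num

/-! ## Part E — Orlov's isometric group `U(A × Â)`: `2 × 2` over a ring with involution, and over `ℤ[i]` -/

/-- **Orlov's isometric condition, `2 × 2`.**  Over a commutative ring with involution `*` (the Rosati involution
of `End(A)`, `Â` identified with `A` by a principal polarisation), `f = (α β; γ δ)` is ISOMETRIC iff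
`f · f̃ = 1` with `f̃ = (δ* −β*; −γ* α*)` [Orlov, alg-geom/9712017, Def. of `U(A × B)` p. 8, Prop 2.21, Thm 4.14].
Written out, the four entries of `f·f̃ = 1` force `f* = (det f)* · f` entrywise and `det f · (det f)* = 1`. -/
theorem isometric_entry_law {S : Type*} [CommRing S] [StarRing S] {α β γ δ : S}
    (h11 : α * star δ - β * star γ = 1) (h12 : β * star α = α * star β)
    (h21 : γ * star δ = δ * star γ) (h22 : δ * star α - γ * star β = 1) :
    star α = star (α * δ - β * γ) * α ∧ star β = star (α * δ - β * γ) * β ∧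
      star γ = star (α * δ - β * γ) * γ ∧ star δ = star (α * δ - β * γ) * δ ∧
      (α * δ - β * γ) * star (α * δ - β * γ) = 1 := by
  simp only [star_sub, star_mul']
  refine ⟨?_, ?_, ?_, ?_, ?_⟩
  · linear_combination (-(star α)) * h11 + (-(star γ)) * h12
  · linear_combination (-(star δ)) * h12 + (-(star β)) * h11
  · linear_combination (-(star α)) * h21 + (-(star γ)) * h22
  · linear_combination (-(star δ)) * h22 + (-(star β)) * h21
  · linear_combination (α * star δ - β * star γ) * h22 + h11 + (α * star β - β * star α) * h21

/-- **Over `ℤ[i]`** (`End` of the very general principally polarised fibre of the Weil family, `*` = Rosati =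
complex conjugation): an isometric `f` has either all entries REAL and `det f = 1` (`f ∈ SL₂(ℤ)`: the modular group
`⟨Φ_𝒫, ⊗𝒪(H)⟩`, with `−1 = [−1]^*`) or all entries PURELY IMAGINARY and `det f = −1` (`f ∈ i·SL₂(ℤ)`: composed
with the CM unit `[i]_* = i·1`, which flips the Weil letters `e, ē ↦ −e, −ē` — g1's convention sign `ε`).
With Orlov's Thm 4.14 this is the COMPLETE list of FM self-symmetries of that fibre modulo shifts, translations
and `Pic⁰`. -/
theorem gaussian_isometric {α β γ δ : ℤ√(-1)}
    (h11 : α * star δ - β * star γ = 1) (h12 : β * star α = α * star β)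
    (h21 : γ * star δ = δ * star γ) (h22 : δ * star α - γ * star β = 1) :
    (α.im = 0 ∧ β.im = 0 ∧ γ.im = 0 ∧ δ.im = 0 ∧ α * δ - β * γ = 1) ∨
      (α.re = 0 ∧ β.re = 0 ∧ γ.re = 0 ∧ δ.re = 0 ∧ α * δ - β * γ = -1) := by
  obtain ⟨hα, hβ, hγ, hδ, hu⟩ := isometric_entry_law h11 h12 h21 h22
  generalize hud : α * δ - β * γ = u at hα hβ hγ hδ hu ⊢
  obtain ⟨u1, u2⟩ := u
  have nu : u1 * u1 + u2 * u2 = 1 := by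
    have := congrArg Zsqrtd.re hu
    simp at this
    linarith
  have hcases : (u1 = 1 ∧ u2 = 0) ∨ (u1 = -1 ∧ u2 = 0) ∨ (u1 = 0 ∧ u2 = 1) ∨ (u1 = 0 ∧ u2 = -1) := by
    have h1 : u1 ≤ 1 := by nlinarith [sq_nonneg u2, sq_nonneg (u1 - 1)]
    have h2 : -1 ≤ u1 := by nlinarith [sq_nonneg u2, sq_nonneg (u1 + 1)]
    have h3 : u2 ≤ 1 := by nlinarith [sq_nonneg u1, sq_nonneg (u2 - 1)]
    have h4 : -1 ≤ u2 := by nlinarith [sq_nonneg u1, sq_nonneg (u2 + 1)]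
    interval_cases u1 <;> interval_cases u2 <;> omega
  obtain ⟨a1, a2⟩ := α
  obtain ⟨b1, b2⟩ := β
  obtain ⟨c1, c2⟩ := γ
  obtain ⟨d1, d2⟩ := δ
  have ea := hα
  have eb := hβ
  have ec := hγ
  have ed := hδ
  have edet := hud
  simp [Zsqrtd.ext_iff] at ea eb ec ed edet
  rcases hcases with ⟨rfl, rfl⟩ | ⟨rfl, rfl⟩ | ⟨rfl, rfl⟩ | ⟨rfl, rfl⟩
  · -- `det = 1`: all entries real
    left
    dsimp only
    refine ⟨by omega, by omega, by omega, by omega, ?_⟩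
    ext <;> simp
  · -- `det = −1`: all entries purely imaginary
    right
    dsimp only
    refine ⟨by omega, by omega, by omega, by omega, ?_⟩
    ext <;> simp
  · -- `det = i`: every entry in `(1 + i)ℤ`, so `det ∈ 2iℤ` — impossible (parity)
    exfalso
    have ea1 : a1 = a2 := by omega
    have eb1 : b1 = b2 := by omega
    have ec1 : c1 = c2 := by omega
    have ed1 : d1 = d2 := by omega
    subst ea1 eb1 ec1 ed1
    ring_nf at edet
    omega
  · -- `det = −i`: every entry in `(1 − i)ℤ` — impossible (parity)
    exfalso
    have ea1 : a1 = -a2 := by omega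
    have eb1 : b1 = -b2 := by omega
    have ec1 : c1 = -c2 := by omega
    have ed1 : d1 = -d2 := by omega
    subst ea1 eb1 ec1 ed1
    ring_nf at edet
    omega

/-- The two generators are isometric: `M_S = (0 1; −1 0)` (`Φ_𝒫`; any ring with involution) … -/
theorem fm_isometric {S : Type*} [CommRing S] [StarRing S] :
    (0 : S) * star (0 : S) - 1 * star (-1 : S) = 1 ∧ (1 : S) * star (0 : S) = 0 * star (1 : S) ∧
      (-1 : S) * star (0 : S) = 0 * star (-1 : S) ∧ (0 : S) * star (0 : S) - (-1) * star (1 : S) = 1 := by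
  simp

/-- … and `M_T = (1 0; λ 1)` (`⊗𝒪(H)`, `λ = φ_H` self-adjoint: `λ* = λ`). -/
theorem twist_isometric {S : Type*} [CommRing S] [StarRing S] {l : S} (hl : star l = l) :
    (1 : S) * star (1 : S) - 0 * star l = 1 ∧ (0 : S) * star (1 : S) = 1 * star (0 : S) ∧
      l * star (1 : S) = 1 * star l ∧ (1 : S) * star (1 : S) - l * star (0 : S) = 1 := by
  simp [hl]

end Summit.HodgeConjecture.HodgeConjecture.Cruxes.BlochSeedDiscOne.FourierMukaiModularLaw
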